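import Mathlib
import HarnessLib
import Summits.Langlands.Langlands.Theorems.TriangulineChamberLiftB2CrysSplitPCompletion
import Literature.NumberTheory.GaloisRepresentations.IntegralGaloisAction
import Literature.NumberTheory.Automorphic.GaloisActionPlaces

/-!
# Stub `stub_splitPrime` (line `local_clause_cut`, crux `EmptyWeightCore`, stmt-Langlands-17008)

A rational prime `p` that SPLITS in a quadratic number field `F` (two distinct places `v₀ ≠ w₀`
of `F` above `p`) has `e = f = 1` at EVERY place `v ∣ p`:

* `N v = p` (`v.residueCard = p`),
* `v` is unramified over `p` (`v² ∤ (p)`),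
* `p` is a uniformiser of the completion `F_v`, i.e. an irreducible element of the valuation
  ring `𝒪[F_v]` of the local field `F_v` (tree instance `instValuativeRelAdicCompletion`).

Proof.  The fundamental identity `Σ_{q ∣ p} e_q f_q = [𝓞 F : ℤ] = [F : ℚ] = 2` (Mathlib
`Ideal.sum_ramification_inertia_eq_finrank` over `ℤ`, `NumberField.RingOfIntegers.rank`) has at
least the two summands at `v` and at a place `u ≠ v` above `p` (one of `v₀, w₀`), each `≥ 1`, so
`e_v f_v = 1`.  Then `N v = p ^ f_v = p` (Mathlib `Ideal.absNorm_eq_pow_inertiaDeg'`), `e_v = 1`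
gives `(p) ⊄ v²` (Mathlib `Ideal.ramificationIdx'_ne_one_iff`), and in `F_v` the element `p` has
the largest valuation `< 1` (`valuation_le_valuation_natCast_of_lt_one`), hence is irreducible in
`𝒪[F_v]` (a product of two non-units has valuation `≤ |p|² < |p|`).

Reference: Neukirch, *Algebraic Number Theory* (1999), Ch. I §8 Prop. (8.2) (`Σ eᵢ fᵢ = n`) and
§9 Prop. (9.1); Marcus, *Number Fields*, Ch. 3, Thm. 21.  No `sorry`, no new definitions.
-/

-- project-wide option (lakefile weak.linter.dupNamespace); `Summit.Langlands.Langlands` is mandated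
set_option linter.dupNamespace false

noncomputable section

namespace Summit.Langlands.Langlands.Cruxes.EmptyWeightCore.LocalClauseCut

open Literature.NumberTheory.GaloisRepresentations Field IsDedekindDomain NumberField ValuativeRel

section SplitPrimeHelpers

variable {F : Type} [Field F] [NumberField F] (p : ℕ) [Fact p.Prime]

omit [NumberField F] in
/-- A place `v` of `F` with `p ∈ v` lies over the prime `p ℤ` of `ℤ` (Mathlib
`Ideal.liesOver_span_iff`). [folklore] -/
theorem splitPrime_liesOver_span {v : HeightOneSpectrum (𝓞 F)}
    (hv : ((p : ℕ) : 𝓞 F) ∈ v.asIdeal) : v.asIdeal.LiesOver (Ideal.span {(p : ℤ)}) :=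
  (Ideal.liesOver_span_iff v.isPrime.ne_top (Nat.prime_iff_prime_int.mp Fact.out)).2
    (by simpa using hv)

omit [NumberField F] [Fact p.Prime] in
/-- The extension of `p ℤ` to `𝓞 F` is the principal ideal `(p)`. [folklore] -/
theorem splitPrime_map_span :
    (Ideal.span {(p : ℤ)}).map (algebraMap ℤ (𝓞 F)) = Ideal.span {((p : ℕ) : 𝓞 F)} := by
  rw [Ideal.map_span, Set.image_singleton, map_natCast]

/-- **Split ⇒ `e_v f_v = 1`.** If `p` has two distinct places of the quadratic field `F` above
it, then every place `v ∣ p` has `e(v|p) f(v|p) = 1`, hence `e(v|p) = f(v|p) = 1` (the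
fundamental identity `Σ e f = [F : ℚ] = 2` over `ℤ`, Mathlib
`Ideal.sum_ramification_inertia_eq_finrank`, with at least two summands `≥ 1`).
[cite: NeukirchANT1999, Ch. I §8 Prop. (8.2)] -/
theorem splitPrime_ramificationIdx_inertiaDeg_eq_one [Algebra.IsQuadraticExtension ℚ F]
    (hsplit : ∃ v w : HeightOneSpectrum (𝓞 F), v ≠ w ∧
      ((p : ℕ) : 𝓞 F) ∈ v.asIdeal ∧ ((p : ℕ) : 𝓞 F) ∈ w.asIdeal)
    {v : HeightOneSpectrum (𝓞 F)} (hv : ((p : ℕ) : 𝓞 F) ∈ v.asIdeal) :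
    v.asIdeal.ramificationIdx ℤ = 1 ∧ v.asIdeal.inertiaDeg ℤ = 1 := by
  obtain ⟨v₀, w₀, hne, hv₀, hw₀⟩ := hsplit
  -- a second place `u ≠ v` above `p`
  obtain ⟨u, hu, huv⟩ : ∃ u : HeightOneSpectrum (𝓞 F), ((p : ℕ) : 𝓞 F) ∈ u.asIdeal ∧ u ≠ v := by
    by_cases h : v₀ = v
    · exact ⟨w₀, hw₀, fun h' => hne (h.trans h'.symm)⟩
    · exact ⟨v₀, hv₀, h⟩
  set P : Ideal ℤ := Ideal.span {(p : ℤ)}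
  have hsum := Ideal.sum_ramification_inertia_eq_finrank P (𝓞 F)
  rw [RingOfIntegers.rank, Algebra.IsQuadraticExtension.finrank_eq_two ℚ F] at hsum
  have hmem : ∀ {w : HeightOneSpectrum (𝓞 F)}, ((p : ℕ) : 𝓞 F) ∈ w.asIdeal →
      w.asIdeal ∈ P.primesOver (𝓞 F) :=
    fun hw => ⟨inferInstance, splitPrime_liesOver_span p hw⟩
  have hf1 : ∀ q : P.primesOver (𝓞 F), 1 ≤ q.1.ramificationIdx ℤ * q.1.inertiaDeg ℤ :=
    fun q => by
      haveI : q.1.IsPrime := q.2.1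
      exact Nat.one_le_iff_ne_zero.2 (Nat.mul_ne_zero (Ideal.ramificationIdx_pos q.1 ℤ).ne'
        (Ideal.inertiaDeg_pos q.1 ℤ).ne')
  obtain ⟨a, ha⟩ : ∃ a : P.primesOver (𝓞 F), a.1 = v.asIdeal := ⟨⟨v.asIdeal, hmem hv⟩, rfl⟩
  obtain ⟨b, hb⟩ : ∃ b : P.primesOver (𝓞 F), b.1 = u.asIdeal := ⟨⟨u.asIdeal, hmem hu⟩, rfl⟩
  have hab : a ≠ b := fun h =>
    huv (HeightOneSpectrum.ext (hb.symm.trans ((congrArg Subtype.val h).symm.trans ha)))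
  have hle :
      a.1.ramificationIdx ℤ * a.1.inertiaDeg ℤ + b.1.ramificationIdx ℤ * b.1.inertiaDeg ℤ ≤ 2 :=
    calc a.1.ramificationIdx ℤ * a.1.inertiaDeg ℤ + b.1.ramificationIdx ℤ * b.1.inertiaDeg ℤ
        = ∑ q ∈ ({a, b} : Finset (P.primesOver (𝓞 F))),
            q.1.ramificationIdx ℤ * q.1.inertiaDeg ℤ :=
          (Finset.sum_pair
            (f := fun q : P.primesOver (𝓞 F) => q.1.ramificationIdx ℤ * q.1.inertiaDeg ℤ) hab).symm
      _ ≤ ∑ q : P.primesOver (𝓞 F), q.1.ramificationIdx ℤ * q.1.inertiaDeg ℤ :=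
          Finset.sum_le_sum_of_subset (Finset.subset_univ _)
      _ = 2 := hsum
  have hfa : a.1.ramificationIdx ℤ * a.1.inertiaDeg ℤ = 1 := by
    have h1 := hf1 a
    have h2 := hf1 b
    omega
  rw [ha] at hfa
  exact ⟨Nat.eq_one_of_mul_eq_one_right hfa, Nat.eq_one_of_mul_eq_one_left hfa⟩

/-- `f(v|p) = 1 ⇒ N v = p` (`N v = p ^ f(v|p)`, Mathlib `Ideal.absNorm_eq_pow_inertiaDeg'`).
[folklore] -/
theorem splitPrime_residueCard_eq {v : HeightOneSpectrum (𝓞 F)}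
    (hv : ((p : ℕ) : 𝓞 F) ∈ v.asIdeal) (hf : v.asIdeal.inertiaDeg ℤ = 1) :
    v.residueCard = p := by
  haveI := splitPrime_liesOver_span p hv
  haveI := v.isMaximal
  change Ideal.absNorm v.asIdeal = p
  rw [Ideal.absNorm_eq_pow_inertiaDeg' v.asIdeal (Fact.out : p.Prime),
    Ideal.inertiaDeg'_eq_inertiaDeg, hf, pow_one]

/-- `e(v|p) = 1 ⇒ v² ∤ (p)` (Mathlib `Ideal.ramificationIdx'_ne_one_iff`,
`Ideal.ramificationIdx'_eq_ramificationIdx`). [folklore] -/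
theorem splitPrime_not_sq_dvd {v : HeightOneSpectrum (𝓞 F)}
    (hv : ((p : ℕ) : 𝓞 F) ∈ v.asIdeal) (he : v.asIdeal.ramificationIdx ℤ = 1) :
    ¬ v.asIdeal ^ 2 ∣ Ideal.span {((p : ℕ) : 𝓞 F)} := by
  haveI := splitPrime_liesOver_span p hv
  have hp0 : (Ideal.span {(p : ℤ)} : Ideal ℤ) ≠ ⊥ := by
    rw [Ne, Ideal.span_singleton_eq_bot]
    exact_mod_cast (Fact.out : p.Prime).ne_zero
  have h1 : (Ideal.span {(p : ℤ)}).ramificationIdx' v.asIdeal = 1 := by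
    rw [Ideal.ramificationIdx'_eq_ramificationIdx _ _ hp0, he]
  have hle : (Ideal.span {(p : ℤ)}).map (algebraMap ℤ (𝓞 F)) ≤ v.asIdeal := by
    rw [splitPrime_map_span, Ideal.span_singleton_le_iff_mem]
    exact hv
  have h2 := (not_iff_not.2 (Ideal.ramificationIdx'_ne_one_iff hle)).1 (not_not.2 h1)
  rwa [splitPrime_map_span, ← Ideal.dvd_iff_le] at h2

/-- **`p` is a uniformiser of `F_v` when `v ∣ p` is unramified**: `p` is irreducible in the
valuation ring `𝒪[F_v]` (`|p|_v < 1`, so `p` is not a unit; `|x| < 1 ⇒ |x| ≤ |p|` by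
`valuation_le_valuation_natCast_of_lt_one`, so a factorisation `p = a b` into two non-units would
give `|p| ≤ |p|² < |p|`; Neukirch, ANT, Ch. II §3). [folklore] -/
theorem splitPrime_irreducible_natCast {v : HeightOneSpectrum (𝓞 F)}
    (hv : ((p : ℕ) : 𝓞 F) ∈ v.asIdeal) (he : ¬ v.asIdeal ^ 2 ∣ Ideal.span {((p : ℕ) : 𝓞 F)}) :
    Irreducible ((p : ℕ) : 𝒪[v.adicCompletion F]) := by
  have hp1 : valuation (v.adicCompletion F) (p : v.adicCompletion F) < 1 :=
    LocalField.valuation_adicCompletion_natCast_lt_one v p hv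
  have hunif : ∀ x : v.adicCompletion F, valuation (v.adicCompletion F) x < 1 →
      valuation (v.adicCompletion F) x ≤ valuation (v.adicCompletion F) (p : v.adicCompletion F) :=
    fun x hx =>
      Summit.Langlands.Langlands.Theorems.LiftB2CrysSplitP.valuation_le_valuation_natCast_of_lt_one
        v p hv he x hx
  have hcoe :
      (((p : ℕ) : 𝒪[v.adicCompletion F]) : v.adicCompletion F) = (p : v.adicCompletion F) := rfl
  refine ⟨?_, fun a b hab => ?_⟩
  · rw [Valuation.Integer.not_isUnit_iff_valuation_lt_one, hcoe]
    exact hp1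
  · by_contra h
    rw [not_or, Valuation.Integer.not_isUnit_iff_valuation_lt_one,
      Valuation.Integer.not_isUnit_iff_valuation_lt_one] at h
    have ha := hunif _ h.1
    have hb := hunif _ h.2
    have hmul : valuation (v.adicCompletion F) (p : v.adicCompletion F) =
        valuation (v.adicCompletion F) (a : v.adicCompletion F) *
          valuation (v.adicCompletion F) (b : v.adicCompletion F) := by
      rw [← map_mul, ← hcoe, hab]
      rfl
    have hp0 : valuation (v.adicCompletion F) (p : v.adicCompletion F) ≠ 0 := by
      rw [Ne, map_eq_zero]
      haveI := LocalField.charZero_adicCompletion v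
      exact Nat.cast_ne_zero.2 (Fact.out : p.Prime).ne_zero
    have hlt : valuation (v.adicCompletion F) (a : v.adicCompletion F) *
        valuation (v.adicCompletion F) (b : v.adicCompletion F) <
        valuation (v.adicCompletion F) (p : v.adicCompletion F) :=
      calc valuation (v.adicCompletion F) (a : v.adicCompletion F) *
            valuation (v.adicCompletion F) (b : v.adicCompletion F)
          ≤ valuation (v.adicCompletion F) (p : v.adicCompletion F) *
            valuation (v.adicCompletion F) (p : v.adicCompletion F) := mul_le_mul' ha hb
        _ < valuation (v.adicCompletion F) (p : v.adicCompletion F) * 1 :=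
            mul_lt_mul_of_pos_left hp1 (zero_lt_iff.2 hp0)
        _ = _ := mul_one _
    exact absurd hmul hlt.ne'

end SplitPrimeHelpers

/-- **STUB B — a split prime of a quadratic field has `e = f = 1` everywhere above it.**  If the
rational prime `p` has two distinct places `v₀ ≠ w₀` of the quadratic field `F` above it, then every
place `v ∣ p` has residue cardinality `N v = p`, is unramified (`v² ∤ (p)`), and `p` is a uniformiser
of the completion `F_v` (an irreducible element of its valuation ring `𝒪[F_v]`).  (`Σ e_i f_i = 2`
with at least two summands, Mathlib `Ideal.sum_ramification_inertia_eq_finrank` over `ℤ`;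
`Ideal.absNorm_eq_pow_inertiaDeg'`, `Ideal.ramificationIdx'_ne_one_iff`; for the uniformiser,
`valuation_le_valuation_natCast_of_lt_one`.)
[cite: NeukirchANT1999, Ch. I §8 Prop. (8.2) and §9 Prop. (9.1)] -/
theorem stub_splitPrime :
    ∀ (F : Type) [Field F] [NumberField F] [Algebra.IsQuadraticExtension ℚ F] (p : ℕ)
      [Fact p.Prime],
      (∃ v w : HeightOneSpectrum (𝓞 F), v ≠ w ∧
          ((p : ℕ) : 𝓞 F) ∈ v.asIdeal ∧ ((p : ℕ) : 𝓞 F) ∈ w.asIdeal) →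
      ∀ (v : HeightOneSpectrum (𝓞 F)), ((p : ℕ) : 𝓞 F) ∈ v.asIdeal →
        v.residueCard = p ∧ ¬ v.asIdeal ^ 2 ∣ Ideal.span {((p : ℕ) : 𝓞 F)} ∧
          Irreducible ((p : ℕ) : 𝒪[v.adicCompletion F]) := by
  intro F _ _ _ p _ hsplit v hv
  obtain ⟨he, hf⟩ := splitPrime_ramificationIdx_inertiaDeg_eq_one p hsplit hv
  have hsq := splitPrime_not_sq_dvd p hv he
  exact ⟨splitPrime_residueCard_eq p hv hf, hsq, splitPrime_irreducible_natCast p hv hsq⟩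

end Summit.Langlands.Langlands.Cruxes.EmptyWeightCore.LocalClauseCut

end
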